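import Mathlib
import HarnessLib
import Summits.HubbardSuperconductivity.HubbardSuperconductivity.Theorems.KLProgrammeC4aAliasJets
import Summits.HubbardSuperconductivity.HubbardSuperconductivity.Theorems.KLProgrammeC4aCoMovingJetsL1

/-!
# Route `KLProgramme` — crux C4a, the (A)-closer's ONE-LINE JETS ASSEMBLY: angular jets of `θ ↦ Re tadpoleCont(k_F^K θ)` = tube tadpole-jet theorem on each
# kept frequency (Jacobian jets × co-moving `L¹(dϑ)` dominators × slice mass) + Bell's bound for the aliasing term

Cell `gate-hubbard-kl`, lane hubbard-kl-c4a-1 (g5); helper for stub (C) `stub_twoLeg_curvature` of the engine-flow child `KLRegimeEngineV17F2`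
(stmt-HubbardSuperconductivity-20437); memo HOME/hubbard-kl-c4a-1/C4A-PLAN.md §12.1/§12.5/§16.  With `…C4aAvg8Jets.twoLegCurveJetBound_succ_of_jets` the
(A) half of stub (C) at scale `n+1` is the four sup-jet bounds of ONE function `F = Re[tadpoleCont + localReadingCont R₁ + localReadingCont R₂] ∘ k_F^K`; this file
bounds the jets of its ONE-LINE part `F₁ = Re tadpoleCont ∘ k_F^K` from NAMED analytic inputs:

* §1 calculus: `iteratedDeriv_re` (`∂ʲ Re g = Re ∂ʲ g`), `bell4 Mk D j` (Bell's polynomials of `abs_iteratedDeriv_comp_le_bell`, orders `0…4`);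
* §2 **`abs_iteratedDeriv_re_tadpoleCont_comp_le`** — for `j ≤ N ≤ 4`, under the band hypotheses at the tube radius `r` (`0 < Λ ≤ Λ′ < r`), Jacobian jets
  `‖∂ⁱ_s J(ρ,s)‖ ≤ G_i` (`hJjet`; discharged by `…C4aJacobianCertJets.hJjet_cert`), co-moving `L¹(dϑ)` dominators `CoMovingJetsL1 N (aV p₀) r μ K (tadpoleVertex β W p₀)`
  with uniform angular integrals `≤ Mv p₀ i` (THE (L3) INPUT, per kept frequency), alias derivative tables `Da p₀` (`M ≥ 4`) and the Fermi-point jets `‖γ⁽ⁱ⁾‖ ≤ D_i`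
  (`γ = toLp ∘ k_F^K`, `…PerturbedFermiCurveTower`):
  `|∂_θʲ Re tadpoleCont(k_F θ)| ≤ (2π)⁻²·Σ_{p₀}(Σ_{i≤j} C(j,i)·G_i·Mv_{p₀,j−i})·∫‖ŝ_{p₀}‖ + bell4 (Lᵏ·mass·Σ_{p₀}tail_{p₀}) D j`
  — `tadpoleCont_eq_tubeTadpoles_add_alias` + `norm_iteratedDeriv_tubeTadpole_le_of_L1_unif` + `abs_iteratedDeriv_re_aliasSum_comp_le`.

So, with `…C4aTadpoleValueAssembly` (k = 0, paired) and this file (k ≥ 1), the one-line term of (A) is reduced to: the (L3) dominators of `tadpoleVertex β 𝒱_n p₀`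
(values: odd-differences; jets: `CoMovingJetsL1`), the certified Jacobian table, p2's alias tables, and the Fermi-point sizes — all named.  Composition only; nothing
is asserted about the Hubbard model's sizes; nothing asserts superconductivity.  References: BGM 2006 §2.4 (2.36)–(2.40) [cite: BenfattoGiulianiMastropietro2006];
FST II CPAM 51 (1998) §3 (Thm 3.5).
-/

noncomputable section

namespace Summit.HubbardSuperconductivity.HubbardSuperconductivity.Theorems.C4a

set_option linter.dupNamespace false -- summit = problem name (single-conjunct summit), D-0017

open Real Set MeasureTheory Finset
open scoped ContDiff
open Literature.MathematicalPhysics.QuantumLattice Literature.MathematicalPhysics.QuantumLattice.BandSectorCounting Literature.Probability.LatticeModels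
open GrassmannAlgebra
open Summit.HubbardSuperconductivity.HubbardSuperconductivity.Theorems.KLRegimeSplit
open Summit.HubbardSuperconductivity.HubbardSuperconductivity.Theorems.DispersionFlow
open Summit.HubbardSuperconductivity.HubbardSuperconductivity.Theorems.PerturbedFermiCurve

/-! ## §1 Calculus: real parts under angular derivatives; Bell's polynomials to order four -/

/-- `∂ʲ(Re g) = Re(∂ʲ g)` for a `Cʲ` complex-valued function of one real variable. -/
theorem iteratedDeriv_re {g : ℝ → ℂ} {n : ℕ} (hg : ContDiff ℝ n g) (x : ℝ) :
    iteratedDeriv n (fun x : ℝ => (g x).re) x = (iteratedDeriv n g x).re := by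
  have hcomp : (fun x : ℝ => (g x).re) = ⇑Complex.reCLM ∘ g := rfl
  rw [iteratedDeriv_eq_iteratedFDeriv, hcomp, Complex.reCLM.iteratedFDeriv_comp_left hg.contDiffAt le_rfl,
    ContinuousLinearMap.compContinuousMultilinearMap_coe, Function.comp_apply, Complex.reCLM_apply, ← iteratedDeriv_eq_iteratedFDeriv]

/-- `|∂ʲ(Re g)| ≤ ‖∂ʲ g‖`. -/
theorem abs_iteratedDeriv_re_le {g : ℝ → ℂ} {n : ℕ} (hg : ContDiff ℝ n g) (x : ℝ) :
    |iteratedDeriv n (fun x : ℝ => (g x).re) x| ≤ ‖iteratedDeriv n g x‖ := by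
  rw [iteratedDeriv_re hg]
  exact Complex.abs_re_le_norm _

/-- **Bell's polynomials to order four** (the right-hand sides of `abs_iteratedDeriv_comp_le_bell`, with the value bound `Mk 0` at order `0`). -/
def bell4 (Mk D : ℕ → ℝ) : ℕ → ℝ
  | 0 => Mk 0
  | 1 => Mk 1 * D 1
  | 2 => Mk 2 * D 1 ^ 2 + Mk 1 * D 2
  | 3 => Mk 3 * D 1 ^ 3 + 3 * Mk 2 * D 1 * D 2 + Mk 1 * D 3
  | 4 => Mk 4 * D 1 ^ 4 + 6 * Mk 3 * D 1 ^ 2 * D 2 + 3 * Mk 2 * D 2 ^ 2 + 4 * Mk 2 * D 1 * D 3 + Mk 1 * D 4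
  | _ => 0

/-! ## §2 The one-line jets assembly -/

section Assembly

variable {L M : ℕ} [NeZero L] [NeZero M]
variable {a b : ℝ} (B : BandBounds a b) {K : TrigPolyC4v} {A : ℝ}
  (hA : ∀ p : Momentum, ∀ j ≤ 2, ‖iteratedFDeriv ℝ j (frameShift K) p‖ ≤ A) (hADt : 2 * A < B.Dtmin)
  {μ r : ℝ} (hr : 0 < r) (hlo : a < μ - r - A) (hhi : μ + r + A < b)
include B hA hADt hr hlo hhi

omit B hA hADt hr hlo hhi in
/-- **The aliasing part along the Fermi curve, all orders `j ≤ 4` in one bound** (value at `j = 0`, Bell at `1 ≤ j ≤ 4`). -/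
theorem abs_iteratedDeriv_re_aliasSum_comp_le_bell4 {β : ℝ} (W : HubbardGrassmann L M) {e : MatsubaraIdx M → TorusSite 2 L → ℂ}
    {τ : MatsubaraIdx M → ℝ} (he : ∀ p₀ y, ‖e p₀ y‖ ≤ τ p₀) {γ : ℝ → Momentum} (hγ : ContDiff ℝ 4 γ) {θ : ℝ} {D : ℕ → ℝ}
    (hD : ∀ i, 1 ≤ i → i ≤ 4 → ‖iteratedDeriv i γ θ‖ ≤ D i) {Mk : ℕ → ℝ}
    (hMk : ∀ k, Mk k = (L : ℝ) ^ k * (6 * |β| * (L : ℝ) ^ 4 * ∑ σ : Fin 2, ∑ τ : Fin 2, 2 * (((Fintype.card (SpaceTimeIdx L M) : ℝ) ^ 4)⁻¹ *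
        ∑ x : Fin 4 → SpaceTimeIdx L M, ‖positionKernel L M β W 4 (fun i => ((x i, ![σ, σ, τ, τ] i), (![0, 1, 1, 0] : Fin 4 → Fin 2) i))‖)) *
          ∑ p₀ : MatsubaraIdx M, τ p₀) {j : ℕ} (hj : j ≤ 4) :
    |iteratedDeriv j ((fun P : Momentum => (∑ p₀ : MatsubaraIdx M, ∑ y : TorusSite 2 L, tadpoleCoeff β W p₀ (WithLp.ofLp P) y * e p₀ y).re) ∘ γ) θ| ≤
      bell4 Mk D j := by
  have hτ : ∀ p₀, 0 ≤ τ p₀ := fun p₀ => (norm_nonneg _).trans (he p₀ 0)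
  obtain ⟨b1, b2, b3, b4⟩ := abs_iteratedDeriv_re_aliasSum_comp_le β W he hγ hD hMk
  interval_cases j
  · -- the value
    simp only [iteratedDeriv_zero, Function.comp_apply, bell4]
    refine (Complex.abs_re_le_norm _).trans ((norm_sum_le _ _).trans ?_)
    rw [hMk, pow_zero, one_mul, Finset.mul_sum]
    refine Finset.sum_le_sum fun p₀ _ => (norm_sum_le _ _).trans ?_
    calc ∑ y : TorusSite 2 L, ‖tadpoleCoeff β W p₀ (WithLp.ofLp (γ θ)) y * e p₀ y‖
        ≤ ∑ y : TorusSite 2 L, ‖tadpoleCoeff β W p₀ (WithLp.ofLp (γ θ)) y‖ * τ p₀ :=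
          Finset.sum_le_sum fun y _ => by rw [norm_mul]; exact mul_le_mul_of_nonneg_left (he p₀ y) (norm_nonneg _)
      _ ≤ _ := by
          rw [← Finset.sum_mul]
          exact mul_le_mul_of_nonneg_right (sum_norm_tadpoleCoeff_le β W p₀ _) (hτ p₀)
  · exact b1
  · exact b2
  · exact b3
  · exact b4

/-- **THE ONE-LINE JETS ASSEMBLY.**  `β ≠ 0`, `0 < Λ ≤ Λ′ < r`, band hypotheses at the frame `K` with tube radius `r`; for every kept frequency `p₀` the vertex
`tadpoleVertex β W p₀` has co-moving `L¹(dϑ)` dominators `CoMovingJetsL1 N (aV p₀) r μ K ·` with uniform angular integrals `≤ Mv p₀ i` (the (L3) input);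
Jacobian jets `≤ G_i`; alias tables `Da p₀` (`M ≥ 4`); the Fermi-point map `γ = toLp ∘ k_F^K` is `C⁴` with `‖γ⁽ⁱ⁾(θ)‖ ≤ D_i`.  Then for `j ≤ N ≤ 4`:
`|∂_θʲ Re tadpoleCont(k_F^K θ)| ≤ (2π)⁻²·Σ_{p₀}(Σ_{i≤j} C(j,i)·G_i·Mv_{p₀,j−i})·∫_{(−r,r)}‖ŝ_{p₀}‖ + bell4 (k ↦ Lᵏ·mass·Σ_{p₀} tail_{p₀}) D j`.
[cite: BenfattoGiulianiMastropietro2006, §2.4 (2.36)] -/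
theorem abs_iteratedDeriv_re_tadpoleCont_comp_le {β : ℝ} (hβ : β ≠ 0) {Λ Λ' : ℝ} (hΛ : 0 < Λ) (hΛΛ' : Λ ≤ Λ') (hΛr : Λ' < r)
    (W : HubbardGrassmann L M) {N : ℕ} (hN : N ≤ 4)
    {G : ℕ → ℝ} (hJjet : ∀ ρ, |ρ| < r → ∀ i ≤ N, ∀ s, ‖iteratedDeriv i (fun s => levelChartJac μ K (ρ, s)) s‖ ≤ G i)
    {aV : MatsubaraIdx M → ℕ → ℝ × ℝ → ℝ} (hVJ : ∀ p₀ : MatsubaraIdx M, CoMovingJetsL1 N (aV p₀) r μ K (tadpoleVertex β W p₀))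
    {Mv : MatsubaraIdx M → ℕ → ℝ} (hMv : ∀ (p₀ : MatsubaraIdx M), ∀ i ≤ N, ∀ ρ ∈ Ioo (-r) r, ∫ ϑ in Ioc 0 (2 * π), aV p₀ i (ρ, ϑ) ≤ Mv p₀ i)
    {Mdeg : ℕ} (hM : 4 ≤ Mdeg) {Da : MatsubaraIdx M → ℝ}
    (hDa : ∀ (p₀ : MatsubaraIdx M) (y : Momentum), ‖iteratedFDeriv ℝ Mdeg (fun y : Momentum =>
      sliceSymbolFnXi (β * (L : ℝ) ^ 2) 0 Λ Λ' (matsubaraFreq β M p₀) (frameLevel μ K ((2 * π) • y))) y‖ ≤ Da p₀)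
    (hγ : ContDiff ℝ 4 fun θ : ℝ => (WithLp.toLp 2 (klFermiPoint μ K θ) : Momentum)) {θ : ℝ} {D : ℕ → ℝ}
    (hD : ∀ i, 1 ≤ i → i ≤ 4 → ‖iteratedDeriv i (fun θ : ℝ => (WithLp.toLp 2 (klFermiPoint μ K θ) : Momentum)) θ‖ ≤ D i)
    {Mk : ℕ → ℝ}
    (hMk : ∀ k, Mk k = (L : ℝ) ^ k * (6 * |β| * (L : ℝ) ^ 4 * ∑ σ : Fin 2, ∑ τ : Fin 2, 2 * (((Fintype.card (SpaceTimeIdx L M) : ℝ) ^ 4)⁻¹ *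
        ∑ x : Fin 4 → SpaceTimeIdx L M, ‖positionKernel L M β W 4 (fun i => ((x i, ![σ, σ, τ, τ] i), (![0, 1, 1, 0] : Fin 4 → Fin 2) i))‖)) *
          ∑ p₀ : MatsubaraIdx M, Da p₀ / (2 * Real.pi) ^ Mdeg * (2 / (L : ℝ)) ^ (Mdeg - 4) * (4 * ∑' k : Fin 2 → ℤ, ∏ j, (1 + (k j : ℝ) ^ 2)⁻¹))
    {j : ℕ} (hj : j ≤ N) :
    |iteratedDeriv j (fun θ : ℝ => (tadpoleCont β μ K Λ Λ' W (klFermiPoint μ K θ)).re) θ| ≤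
      ((2 * π) ^ 2)⁻¹ * (∑ p₀ : MatsubaraIdx M, (∑ i ∈ Finset.range (j + 1), (j.choose i : ℝ) * G i * Mv p₀ (j - i)) *
          ∫ ρ in Ioo (-r) r, ‖sliceSymbolFnXi (β * (L : ℝ) ^ 2) 0 Λ Λ' (matsubaraFreq β M p₀) ρ‖) +
        bell4 Mk D j := by
  have hj4 : j ≤ 4 := hj.trans hN
  -- the two pieces as named functions
  obtain ⟨TT, hTT⟩ : ∃ TT : MatsubaraIdx M → ℝ → ℂ, TT = fun p₀ θ =>
      ∫ q in {q : ℝ × ℝ | |q.1| < π ∧ |q.2| < π ∧ |frameLevel μ K (WithLp.toLp 2 ![q.1, q.2])| < r},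
        sliceSymbolFnXi (β * (L : ℝ) ^ 2) 0 Λ Λ' (matsubaraFreq β M p₀) (frameLevel μ K (WithLp.toLp 2 ![q.1, q.2])) *
          tadpoleVertex β W p₀ (levelPoint μ K 0 θ) (WithLp.toLp 2 ![q.1, q.2]) := ⟨_, rfl⟩
  obtain ⟨Al, hAl⟩ : ∃ Al : Momentum → ℂ, Al = fun P : Momentum =>
      ∑ p₀ : MatsubaraIdx M, ∑ y : TorusSite 2 L, tadpoleCoeff β W p₀ (WithLp.ofLp P) y * aliasErr β μ K Λ Λ' r p₀ y := ⟨_, rfl⟩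
  have hTTcd : ∀ p₀, ContDiff ℝ ∞ (TT p₀) := fun p₀ => by
    rw [hTT]
    exact contDiff_tubeTadpole B hA hADt hr hlo hhi (sliceSymbolFnXi_matsubara_contDiff hβ L M p₀ Λ Λ')
      (sliceSymbolFnXi_matsubara_tsupport_subset L M p₀ hΛ hΛΛ' hΛr) (contDiff_tadpoleVertex β W p₀)
  have hAlcd : ContDiff ℝ 4 Al := by rw [hAl]; exact contDiff_aliasSum β W _
  -- the decomposition along the curve
  have hdec : (fun θ : ℝ => (tadpoleCont β μ K Λ Λ' W (klFermiPoint μ K θ)).re) =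
      fun θ : ℝ => (∑ p₀ : MatsubaraIdx M, ((((2 * π) ^ 2)⁻¹ : ℝ) : ℂ) * TT p₀ θ).re +
        ((fun P : Momentum => (Al P).re) ∘ fun θ : ℝ => (WithLp.toLp 2 (klFermiPoint μ K θ) : Momentum)) θ := by
    funext θ'
    rw [tadpoleCont_eq_tubeTadpoles_add_alias hβ μ K Λ Λ' r W, Complex.add_re, hTT, hAl]
    simp only [Function.comp_apply, levelPoint_zero, Complex.real_smul]
  -- smoothness of the two pieces
  have hTT4 : ∀ p₀, ContDiff ℝ 4 (TT p₀) := fun p₀ => contDiff_infty.1 (hTTcd p₀) 4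
  have hTTj : ∀ p₀, ContDiff ℝ j (TT p₀) := fun p₀ => (hTT4 p₀).of_le (by exact_mod_cast hj4)
  have hsum : ContDiff ℝ 4 fun θ : ℝ => ∑ p₀ : MatsubaraIdx M, ((((2 * π) ^ 2)⁻¹ : ℝ) : ℂ) * TT p₀ θ :=
    ContDiff.sum fun p₀ _ => contDiff_const.mul (hTT4 p₀)
  have h1 : ContDiff ℝ 4 fun θ : ℝ => (∑ p₀ : MatsubaraIdx M, ((((2 * π) ^ 2)⁻¹ : ℝ) : ℂ) * TT p₀ θ).re :=
    Complex.reCLM.contDiff.comp hsum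
  have h2 : ContDiff ℝ 4 ((fun P : Momentum => (Al P).re) ∘ fun θ : ℝ => (WithLp.toLp 2 (klFermiPoint μ K θ) : Momentum)) :=
    (Complex.reCLM.contDiff.comp hAlcd).comp hγ
  rw [hdec, iteratedDeriv_fun_add (h1.contDiffAt.of_le (by exact_mod_cast hj4)) (h2.contDiffAt.of_le (by exact_mod_cast hj4))]
  refine (abs_add_le _ _).trans (add_le_add ?_ ?_)
  · -- the tube tadpoles
    refine (abs_iteratedDeriv_re_le (hsum.of_le (by exact_mod_cast hj4)) θ).trans ?_
    rw [iteratedDeriv_fun_sum fun p₀ _ => ((contDiff_const.mul (hTTj p₀)).contDiffAt :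
      ContDiffAt ℝ j (fun θ => ((((2 * π) ^ 2)⁻¹ : ℝ) : ℂ) * TT p₀ θ) θ)]
    refine (norm_sum_le _ _).trans ?_
    rw [Finset.mul_sum]
    refine Finset.sum_le_sum fun p₀ _ => ?_
    rw [iteratedDeriv_const_mul _ (hTTj p₀).contDiffAt, norm_mul,
      Complex.norm_real, Real.norm_of_nonneg (by positivity)]
    refine mul_le_mul_of_nonneg_left ?_ (by positivity)
    rw [hTT]
    exact norm_iteratedDeriv_tubeTadpole_le_of_L1_unif B hA hADt hr hlo hhi (sliceSymbolFnXi_matsubara_contDiff hβ L M p₀ Λ Λ')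
      (sliceSymbolFnXi_matsubara_tsupport_subset L M p₀ hΛ hΛΛ' hΛr) hJjet (contDiff_tadpoleVertex β W p₀) (hVJ p₀) (hMv p₀) hj θ
  · -- the aliasing term
    rw [hAl]
    exact abs_iteratedDeriv_re_aliasSum_comp_le_bell4 W
      (fun p₀ y => norm_aliasErr_le hβ μ K hΛ hΛΛ' hΛr p₀ hM (hDa p₀) y) hγ hD hMk hj4

end Assembly

end Summit.HubbardSuperconductivity.HubbardSuperconductivity.Theorems.C4a

end
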